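import Summits.KontsevichZagierPeriods.Zeta5Search.TwoTaleOmega.StepAEFL
import Summits.KontsevichZagierPeriods.Zeta5Search.Certificates.TwoTaleTelescopeKitU

/-!
# (bmiss)@Ω — direction `aef`, instantiation kit: cert-2's univariate certificate data as polynomials (cell `pub-zeta5`, cert-2 gen 5)

HONEST FRAMING: systematic search; recurrence certificates; no irrationality claim unless certified. Pure bookkeeping; no named fact,
no `sorry`.

cert-2 g4's family files `Certificates/TwoTaleTelescopeAef*` carry the certificate polynomials `x(a,t) = Σ_j x_j(a) t^j` as encoded
coefficient lists with the evaluator `polyTU xs s a t = x(a, t+s)`.  The generic step theorems `StepAEFL.recL_aef` / `StepAEFR.recR_aef`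
want a `Polynomial ℚ` of bounded degree.  Here: `xPolyU xs a = Σ_j C(x_j(a)) X^j` with `eval_xPolyU`/`polyTU_eq` and `natDegree_xPolyU_le`;
its lattice version `xPolyUh xs a = (xPolyU xs a) ∘ (X/2)` (`polyTU xs s a (u/2) = (xPolyUh xs a).eval (u + 2s)`) with the degree bound; and
`upvalN_intCast` (integer table values cast to `ℚ`).
-/

noncomputable section

open Finset Polynomial
open Summit.KontsevichZagierPeriods.Zeta5Search.Certificates.TwoTaleTelescope

namespace Summit.KontsevichZagierPeriods.Zeta5Search.TwoTaleOmega

/-- The certificate polynomial `x(a,·) = Σ_j x_j(a) X^j` of an encoded univariate coefficient table, at the parameter `a`. -/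
def xPolyU (xs : List (List ℕ)) (a : ℚ) : ℚ[X] :=
  ((List.range xs.length).map fun j => C (upvalN (xs.getD j []) a) * X ^ j).sum

/-- `xPolyU` evaluates to cert-2's `polyTU`: `x(a, t+s) = polyTU xs s a t`. -/
theorem eval_xPolyU (xs : List (List ℕ)) (s : ℤ) (a t : ℚ) : (xPolyU xs a).eval (t + s) = polyTU xs s a t := by
  unfold xPolyU polyTU
  rw [eval_listSum, List.map_map]
  congr 1
  refine List.map_congr_left fun j _ => ?_
  simp only [Function.comp, eval_mul, eval_C, eval_pow, eval_X]

/-- `polyTU` through the polynomial. -/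
theorem polyTU_eq (xs : List (List ℕ)) (s : ℤ) (a t : ℚ) : polyTU xs s a t = (xPolyU xs a).eval (t + s) := (eval_xPolyU xs s a t).symm

/-- Degree bound for a list of monomials. -/
theorem natDegree_listSum_monomial_le (c : ℕ → ℚ) (n : ℕ) :
    ∀ l : List ℕ, (∀ j ∈ l, j ≤ n) → ((l.map fun j => C (c j) * X ^ j).sum : ℚ[X]).natDegree ≤ n
  | [], _ => by simp
  | j :: l, h => by
    rw [List.map_cons, List.sum_cons]
    refine (natDegree_add_le _ _).trans (max_le ?_ (natDegree_listSum_monomial_le c n l fun i hi => h i (List.mem_cons_of_mem _ hi)))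
    exact (natDegree_C_mul_X_pow_le _ _).trans (h j List.mem_cons_self)

/-- `deg x(a,·) ≤ (number of coefficients) − 1`. -/
theorem natDegree_xPolyU_le (xs : List (List ℕ)) (a : ℚ) : (xPolyU xs a).natDegree ≤ xs.length - 1 := by
  unfold xPolyU
  exact natDegree_listSum_monomial_le _ _ _ fun j hj => by have := List.mem_range.1 hj; omega

/-- The lattice version `x(a, u/2)` as a polynomial in `u`. -/
def xPolyUh (xs : List (List ℕ)) (a : ℚ) : ℚ[X] := (xPolyU xs a).comp (C (1 / 2 : ℚ) * X)

/-- `polyTU xs s a (u/2) = (xPolyUh xs a).eval (u + 2s)`. -/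
theorem polyTU_half_eq (xs : List (List ℕ)) (s : ℤ) (a u : ℚ) : polyTU xs s a (u / 2) = (xPolyUh xs a).eval (u + 2 * s) := by
  unfold xPolyUh
  rw [eval_comp, eval_mul, eval_C, eval_X, show (1 : ℚ) / 2 * (u + 2 * s) = u / 2 + s by ring, eval_xPolyU]

/-- Degree bound of the lattice version. -/
theorem natDegree_xPolyUh_le (xs : List (List ℕ)) (a : ℚ) : (xPolyUh xs a).natDegree ≤ xs.length - 1 := by
  unfold xPolyUh
  refine natDegree_comp_le.trans ?_
  rw [natDegree_C_mul_X _ (by norm_num), mul_one]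
  exact natDegree_xPolyU_le xs a

/-- Integer table values cast to `ℚ`: `((upvalN cs a : ℤ) : ℚ) = upvalN cs (a : ℚ)`. -/
theorem upvalN_intCast (a : ℤ) : ∀ cs : List ℕ, ((upvalN cs a : ℤ) : ℚ) = upvalN cs (a : ℚ)
  | [] => by simp [upvalN]
  | c :: cs => by rw [upvalN, upvalN, Int.cast_add, Int.cast_mul, upvalN_intCast a cs]; norm_cast

end Summit.KontsevichZagierPeriods.Zeta5Search.TwoTaleOmega

end
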